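import Summits.CriticalPhenomena.SAWScalingLimit.Theorems.SAWDevelopingMapObservableToSLETypeLadderBandOneEnd
import Summits.CriticalPhenomena.SAWScalingLimit.Theorems.SAWDevelopingMapObservableToSLETypeLadderBandReverse
import HarnessLib

/-!
# The band iteration, two-end assembly (piece I8) for the abundance residue of `ObservableToSLE`

Stub `stub_bandIteration` (line `six-class-type-ladder`, skeleton r16: band-wise cut of the abundance residue)
of the crux `Summit.CriticalPhenomena.SAWScalingLimit.Theses.SAWDevelopingMap.ObservableToSLE`
(item stmt-CriticalPhenomena-10472): band-wise renewal at both ends (`BandRenewal`) and no macroscopic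
backtracking (`NoMacroBacktrackingAt`) imply the abundance of widely linked first good gates for fat co-oriented
solid tame nested designer families — the body of item stmt-CriticalPhenomena-17698, verbatim.

Everything heavy is the ONE-END bound `stub_oneEndBound` (piece I7): for one end it produces, eventually in the
mesh, a tame nested exterior-anchored class-`j` fat solid family with `z₀`-escapes (far radius `2R`, avoiding the
other marked point), levels within `R/2` of the rescaled root, whose "no good gate" probability is small.  Here we
apply it at BOTH ends and combine:

* the `a` end uses the first conjunct of `NoMacroBacktrackingAt D a b` verbatim (root shape at `pt 0`);
* the `b` end reads the walk BACKWARDS: the second conjunct of `NoMacroBacktrackingAt D a b` (target shape at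
  `pt 1`, law from `a δ` to `b δ`) is transported to the root shape for the law from `b δ` to `a δ` by the
  reversal symmetry of the critical SAW law (`stub_hexSAWLaw_reverse_apply`, Madras–Slade 1993 §1.2) and the
  list identity `stub_backtrackEvent_reverse` (`noBacktrack_reverse` below);
* the two families `S` (at `a`) and `T` (at `b`) come with a common class `j` and a common base point `z₀`, so a
  first good gate at each end (from `GoodRenewalAtN` by `stub_firstGoodGateN`) has a `z₀`-escape from its clean
  window, and the two escapes concatenate to a `WideLink` (`wideLink_of_zEscape`) because every level is
  `R`-close to its own marked point, hence `(2R - ρ/4)`-close;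
* the bad event is therefore contained in "no good gate for `S`" ∪ "no good gate for `T` read backwards", and the
  second mass equals, by reversal symmetry again, the "no good gate" mass for the law from `b δ` to `a δ`:
  `ε/2 + ε/2`.

Helpers: `tameNestedFamily_mono` (the complexity bound may be enlarged), `ne_pt_of_mem_carrier` (an interior
point is not a marked boundary point), `noBacktrack_reverse`.
-/

noncomputable section

open scoped BigOperators Topology NNReal ENNReal Classical
open Filter Set MeasureTheory Metric
open Literature.Probability.LatticeModels (HexVertex hexGraph hexCenter triZeta Site)
open Literature.Probability.RandomPlanarGeometry
open Literature.Probability.RandomPlanarGeometry.SAW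

namespace Summit.CriticalPhenomena.SAWScalingLimit.Theorems.ObservableToSLE.TypeLadder

open Summit.CriticalPhenomena.SAWScalingLimit.Theorems.ObservableToSLER.BridgeGate
  (hexBall HasCleanWindow carvedLaw rowOf)
open Summit.CriticalPhenomena.SAWScalingLimit.Theorems.ObservableToSLER.NestedGate

/-! ### Bookkeeping -/

/-- The complexity bound of a tame nested family may be enlarged: a level that is a union of at most `N` lattice
hexagons is a union of at most `N'` of them for `N ≤ N'`. -/
theorem tameNestedFamily_mono {δ R : ℝ} {N N' : ℕ} {c : HexVertex} {S : ℕ → Set HexVertex}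
    (h : TameNestedFamily δ R N c S) (hN : N ≤ N') : TameNestedFamily δ R N' c S := by
  obtain ⟨h1, h2, h3, h4, h5⟩ := h
  refine ⟨h1, h2, h3, h4, fun n => ?_⟩
  obtain ⟨L, hL, hLS⟩ := h5 n
  exact ⟨L, hL.trans hN, hLS⟩

/-- A point of the (open) carrier of a Dobrushin domain is not a marked point: the marked points lie on the
frontier, which is disjoint from the open carrier. -/
theorem ne_pt_of_mem_carrier (D : DobrushinDomain) {z₀ : ℂ} (hz₀ : z₀ ∈ D.carrier) (i : Fin 2) :
    z₀ ≠ D.pt i := by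
  intro h
  have hfr : z₀ ∈ frontier D.carrier := by
    rw [h]
    exact D.pt_mem_frontier i
  have hmem : z₀ ∈ D.carrier ∩ frontier D.carrier := ⟨hz₀, hfr⟩
  rw [D.isOpen.inter_frontier_eq] at hmem
  exact hmem

/-! ### The no-backtracking bound at the far end, read backwards -/

/-- **No backtracking at `pt 1`, root shape for the reversed walk.**  The second conjunct of
`NoMacroBacktrackingAt D a b` bounds, for the law from `a δ` to `b δ`, the event "an entry `r`-close to `pt 1`,
LATER an entry `R′`-far from `pt 1`".  Read backwards (`stub_backtrackEvent_reverse`) this is the event "an entry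
`R′`-far from `pt 1`, LATER an entry `r`-close to it" of the REVERSED list, and by the reversal symmetry of the
critical SAW law (`stub_hexSAWLaw_reverse_apply`) its mass is that of the latter event for the law from `b δ` to
`a δ` — the root-shape no-backtracking hypothesis of the one-end bound at the root `b`. -/
theorem noBacktrack_reverse {D : DobrushinDomain} {a b : ℝ → HexVertex} (hNB : NoMacroBacktrackingAt D a b) :
    ∀ R' > (0 : ℝ), ∀ ε > (0 : ℝ), ∃ r > (0 : ℝ), ∀ᶠ δ : ℝ in 𝓝[>] 0,
      hexSAWLaw D.carrier δ (b δ) (a δ)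
          {γ | ∃ (l₁ l₂ : List HexVertex) (u v : HexVertex), γ.walk.support = l₁ ++ u :: l₂ ∧ v ∈ l₂ ∧
            R' ≤ dist ((δ : ℂ) * hexCenter u) (D.pt 1) ∧ dist ((δ : ℂ) * hexCenter v) (D.pt 1) ≤ r} ≤
        ENNReal.ofReal ε := by
  intro R' hR' ε hε
  obtain ⟨r, hr, h⟩ := hNB R' hR' ε hε
  refine ⟨r, hr, h.mono fun δ hδ => ?_⟩
  have key := stub_hexSAWLaw_reverse_apply D.carrier δ (a δ) (b δ)
    (fun l => ∃ (l₁ l₂ : List HexVertex) (u v : HexVertex), l = l₁ ++ u :: l₂ ∧ v ∈ l₂ ∧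
      R' ≤ dist ((δ : ℂ) * hexCenter u) (D.pt 1) ∧ dist ((δ : ℂ) * hexCenter v) (D.pt 1) ≤ r)
  rw [← key]
  have hset : {γ : HexDomainSAW D.carrier δ (a δ) (b δ) |
      ∃ (l₁ l₂ : List HexVertex) (u v : HexVertex), γ.walk.support.reverse = l₁ ++ u :: l₂ ∧ v ∈ l₂ ∧
        R' ≤ dist ((δ : ℂ) * hexCenter u) (D.pt 1) ∧ dist ((δ : ℂ) * hexCenter v) (D.pt 1) ≤ r} =
      {γ | ∃ (l₁ l₂ : List HexVertex) (u v : HexVertex), γ.walk.support = l₁ ++ u :: l₂ ∧ v ∈ l₂ ∧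
        dist ((δ : ℂ) * hexCenter u) (D.pt 1) ≤ r ∧ R' ≤ dist ((δ : ℂ) * hexCenter v) (D.pt 1)} := by
    ext γ
    exact (stub_backtrackEvent_reverse δ R' r (D.pt 1) γ.walk.support).symm
  rw [hset]
  exact hδ.2

/-! ### The two-end assembly -/

/-- **The band iteration, two-end assembly** (registered stub `stub_bandIteration`, crux item
stmt-CriticalPhenomena-10472, skeleton r16, piece I8): band-wise renewal at both ends and no macroscopic
backtracking imply, for every Dobrushin domain and endpoint approximation and every `ε > 0`, the existence of
scales `R₂`, and for every `R ≤ R₂` of a window radius `ρ` and a complexity `N`, such that eventually in the mesh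
two tame nested exterior-anchored class-`j` fat solid families `S` (at `a`) and `T` (at `b`) exist for which the
walk carries widely linked first good gates at both ends outside an event of probability `≤ ε`.  Proof: the
one-end bound `stub_oneEndBound` at the root `a` (no-backtracking at `pt 0`, escapes far from `pt 1`) and at the
root `b` (no-backtracking at `pt 1` transported by reversal, `noBacktrack_reverse`; escapes far from `pt 0`),
both with `ε/2`; common `R₂ := min`, `ρ := min (min ρa ρb) R`, `N := max`; two good renewals give first good
gates (`stub_firstGoodGateN`) whose `z₀`-escapes concatenate to a wide link (`wideLink_of_zEscape`, the levels
being `R`-close to their marked points); union bound, and reversal symmetry (`stub_hexSAWLaw_reverse_apply`) for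
the `b`-end term. -/
theorem stub_bandIteration :
    (∀ (D : DobrushinDomain) (a b : ℝ → HexVertex), IsEmbEndpointApprox hexGraph hexCenter D a b →
      Summit.CriticalPhenomena.SAWScalingLimit.Theorems.ObservableToSLE.TypeLadder.BandRenewal D a b) →
    (∀ (D : DobrushinDomain) (a b : ℝ → HexVertex), IsEmbEndpointApprox hexGraph hexCenter D a b →
      Summit.CriticalPhenomena.SAWScalingLimit.Theorems.ObservableToSLE.TypeLadder.NoMacroBacktrackingAt D a b) →
    ∀ (D : DobrushinDomain) (a b : ℝ → HexVertex), IsEmbEndpointApprox hexGraph hexCenter D a b →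
      ∀ ε > (0 : ℝ), ∃ R₂ > (0 : ℝ), ∀ R ∈ Set.Ioc (0 : ℝ) R₂, ∃ ρ > (0 : ℝ), ∃ N : ℕ, ∀ᶠ δ : ℝ in 𝓝[>] 0,
        ∃ S T : ℕ → Set HexVertex,
          TameNestedFamily δ R N (a δ) S ∧ TameNestedFamily δ R N (b δ) T ∧
          ((∀ n, ExteriorAnchored D.carrier δ (S n) (a δ)) ∧
            (∀ n, ExteriorAnchored D.carrier δ (T n) (b δ)) ∧
            ∃ j : Fin 6,
              ((∀ (n : ℕ) (p q : HexVertex), HasCleanWindow D.carrier δ ρ (S n) p q →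
                  rowOf j q = rowOf j p + 1 ∧
                    ∀ x : HexVertex, (δ : ℂ) * hexCenter x ∈ ball ((δ : ℂ) * hexCenter q) ρ →
                      (x ∈ S n ↔ rowOf j x ≤ rowOf j p)) ∧
                (∀ (n : ℕ) (p q : HexVertex), HasCleanWindow D.carrier δ ρ (T n) p q →
                  rowOf j q = rowOf j p + 1 ∧
                    ∀ x : HexVertex, (δ : ℂ) * hexCenter x ∈ ball ((δ : ℂ) * hexCenter q) ρ →
                      (x ∈ T n ↔ rowOf j x ≤ rowOf j p))) ∧
              (∀ (n : ℕ) (p q : HexVertex), HasCleanWindow D.carrier δ ρ (S n) p q →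
                ∃ K : Set ℂ, IsCompact K ∧ IsConnected K ∧
                  (δ : ℂ) * hexCenter q - ((ρ / 2 : ℝ) : ℂ) * Complex.I * triZeta ^ (j : ℕ) ∈ K ∧
                  (δ : ℂ) * hexCenter (a δ) ∈ K ∧
                  ∀ v : HexVertex, Metric.infDist ((δ : ℂ) * hexCenter v) K ≤ ρ / 4 → v ∈ S n) ∧
              (∀ (n : ℕ) (p q : HexVertex), HasCleanWindow D.carrier δ ρ (T n) p q →
                ∃ K : Set ℂ, IsCompact K ∧ IsConnected K ∧
                  (δ : ℂ) * hexCenter q - ((ρ / 2 : ℝ) : ℂ) * Complex.I * triZeta ^ (j : ℕ) ∈ K ∧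
                  (δ : ℂ) * hexCenter (b δ) ∈ K ∧
                  ∀ v : HexVertex, Metric.infDist ((δ : ℂ) * hexCenter v) K ≤ ρ / 4 → v ∈ T n) ∧
              (∀ n : ℕ, ∃ K : Set ℂ, IsCompact K ∧ IsConnected K ∧ (δ : ℂ) * hexCenter (a δ) ∈ K ∧
                (∀ v : HexVertex, Metric.infDist ((δ : ℂ) * hexCenter v) K ≤ ρ / 8 → v ∈ S n) ∧
                (∀ v ∈ S n, ∃ (t w : HexVertex) (r : ℕ), v ∈ hexBall t r ∧ w ∈ hexBall t r ∧
                  hexBall t r ⊆ S n ∧ Metric.infDist ((δ : ℂ) * hexCenter w) K ≤ ρ / 16)) ∧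
              (∀ n : ℕ, ∃ K : Set ℂ, IsCompact K ∧ IsConnected K ∧ (δ : ℂ) * hexCenter (b δ) ∈ K ∧
                (∀ v : HexVertex, Metric.infDist ((δ : ℂ) * hexCenter v) K ≤ ρ / 8 → v ∈ T n) ∧
                (∀ v ∈ T n, ∃ (t w : HexVertex) (r : ℕ), v ∈ hexBall t r ∧ w ∈ hexBall t r ∧
                  hexBall t r ⊆ T n ∧ Metric.infDist ((δ : ℂ) * hexCenter w) K ≤ ρ / 16))) ∧
          hexSAWLaw D.carrier δ (a δ) (b δ)
              {γ | ¬ ∃ (n m : ℕ) (p q : HexVertex) (n' m' : ℕ) (p' q' : HexVertex),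
                  IsFirstGoodGateN D.carrier δ ρ R S (a δ) γ.walk.support n m p q ∧
                  IsFirstGoodGateN D.carrier δ ρ R T (b δ) γ.walk.support.reverse n' m' p' q' ∧
                  WideLink D.carrier δ ρ (S n ∪ T n') q q'} ≤
            ENNReal.ofReal ε := by
  intro hBR hNB D a b hab ε hε
  -- (1) band-wise renewal at both ends: one common class `j`, one common base point `z₀ ∈ D`
  obtain ⟨j, z₀, hz₀, hBa, hBb⟩ := hBR D a b hab
  -- (2) no macroscopic backtracking in root shape at both ends (`b` end by reversal)
  have hNBa : ∀ R' > (0 : ℝ), ∀ ε > (0 : ℝ), ∃ r > (0 : ℝ), ∀ᶠ δ : ℝ in 𝓝[>] 0,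
      hexSAWLaw D.carrier δ (a δ) (b δ)
          {γ | ∃ (l₁ l₂ : List HexVertex) (u v : HexVertex), γ.walk.support = l₁ ++ u :: l₂ ∧ v ∈ l₂ ∧
            R' ≤ dist ((δ : ℂ) * hexCenter u) (D.pt 0) ∧ dist ((δ : ℂ) * hexCenter v) (D.pt 0) ≤ r} ≤
        ENNReal.ofReal ε := fun R' hR' ε hε => by
    obtain ⟨r, hr, h⟩ := hNB D a b hab R' hR' ε hε
    exact ⟨r, hr, h.mono fun δ hδ => hδ.1⟩
  have hNBb := noBacktrack_reverse (hNB D a b hab)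
  -- (3) endpoint data: the marked points are distinct and the base point is neither of them
  have h01 : D.pt 0 ≠ D.pt 1 := fun h => absurd (D.pt_injective h) (by decide)
  have hz₀0 : z₀ ≠ D.pt 0 := ne_pt_of_mem_carrier D hz₀ 0
  have hz₀1 : z₀ ≠ D.pt 1 := ne_pt_of_mem_carrier D hz₀ 1
  have hε2 : (0 : ℝ) < ε / 2 := half_pos hε
  -- (4) the one-end bound at both ends, with `ε / 2`
  obtain ⟨Ra, hRa, hA⟩ := stub_oneEndBound D a b (D.pt 0) (D.pt 1) (D.pt 1) z₀ j hBa hNBa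
    hab.tendsto_fst hab.tendsto_snd h01 hz₀0 (ε / 2) hε2
  obtain ⟨Rb, hRb, hB⟩ := stub_oneEndBound D b a (D.pt 1) (D.pt 0) (D.pt 0) z₀ j hBb hNBb
    hab.tendsto_snd hab.tendsto_fst h01.symm hz₀1 (ε / 2) hε2
  refine ⟨min Ra Rb, lt_min hRa hRb, fun R hR => ?_⟩
  have hR0 : 0 < R := hR.1
  obtain ⟨ρa, hρa, hA⟩ := hA R ⟨hR0, hR.2.trans (min_le_left _ _)⟩
  obtain ⟨ρb, hρb, hB⟩ := hB R ⟨hR0, hR.2.trans (min_le_right _ _)⟩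
  have hρ0 : 0 < min (min ρa ρb) R := lt_min (lt_min hρa hρb) hR0
  have hρR : min (min ρa ρb) R ≤ R := min_le_right _ _
  obtain ⟨Na, hA⟩ := hA (min (min ρa ρb) R) ⟨hρ0, (min_le_left _ _).trans (min_le_left _ _)⟩
  obtain ⟨Nb, hB⟩ := hB (min (min ρa ρb) R) ⟨hρ0, (min_le_left _ _).trans (min_le_right _ _)⟩
  refine ⟨min (min ρa ρb) R, hρ0, max Na Nb, ?_⟩
  -- the common window radius, fixed from now on
  generalize min (min ρa ρb) R = ρ at hρ0 hρR hA hB ⊢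
  have hda : ∀ᶠ δ : ℝ in 𝓝[>] 0, dist ((δ : ℂ) * hexCenter (a δ)) (D.pt 0) < R / 2 :=
    Metric.tendsto_nhds.1 hab.tendsto_fst (R / 2) (half_pos hR0)
  have hdb : ∀ᶠ δ : ℝ in 𝓝[>] 0, dist ((δ : ℂ) * hexCenter (b δ)) (D.pt 1) < R / 2 :=
    Metric.tendsto_nhds.1 hab.tendsto_snd (R / 2) (half_pos hR0)
  filter_upwards [hA, hB, hda, hdb] with δ ⟨S, hTS, hES, hCS, hFS, hSpS, hZS, hdS, hPS⟩
    ⟨T, hTT, hET, hCT, hFT, hSpT, hZT, hdT, hPT⟩ hda' hdb'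
  refine ⟨S, T, tameNestedFamily_mono hTS (le_max_left _ _), tameNestedFamily_mono hTT (le_max_right _ _),
    ⟨hES, hET, j, ⟨hCS, hCT⟩, hFS, hFT, hSpS, hSpT⟩, ?_⟩
  -- (5) the bound: every level is `(2R - ρ/4)`-close to the marked point of its own end
  have hU : ∀ n, ∀ v ∈ S n, dist ((δ : ℂ) * hexCenter v) (D.pt 0) ≤ 2 * R - ρ / 4 := by
    intro n v hv
    have h1 := hdS n v hv
    have h2 := dist_triangle ((δ : ℂ) * hexCenter v) ((δ : ℂ) * hexCenter (a δ)) (D.pt 0)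
    linarith [hda'.le]
  have hU' : ∀ n, ∀ v ∈ T n, dist ((δ : ℂ) * hexCenter v) (D.pt 1) ≤ 2 * R - ρ / 4 := by
    intro n v hv
    have h1 := hdT n v hv
    have h2 := dist_triangle ((δ : ℂ) * hexCenter v) ((δ : ℂ) * hexCenter (b δ)) (D.pt 1)
    linarith [hdb'.le]
  -- two good renewals give two first good gates, widely linked through `z₀`
  have hlink : ∀ l : List HexVertex, GoodRenewalAtN D.carrier δ ρ R S (a δ) l →
      GoodRenewalAtN D.carrier δ ρ R T (b δ) l.reverse →
      ∃ (n m : ℕ) (p q : HexVertex) (n' m' : ℕ) (p' q' : HexVertex),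
        IsFirstGoodGateN D.carrier δ ρ R S (a δ) l n m p q ∧
        IsFirstGoodGateN D.carrier δ ρ R T (b δ) l.reverse n' m' p' q' ∧
        WideLink D.carrier δ ρ (S n ∪ T n') q q' := by
    intro l hGS hGT
    obtain ⟨n, m, p, q, hS1⟩ := stub_firstGoodGateN _ _ _ _ _ _ _ hGS
    obtain ⟨n', m', p', q', hT1⟩ := stub_firstGoodGateN _ _ _ _ _ _ _ hGT
    exact ⟨n, m, p, q, n', m', p', q', hS1, hT1,
      wideLink_of_zEscape (hZS n p q hS1.1.2.2.1) (hZT n' p' q' hT1.1.2.2.1) (hU' n') (hU n)⟩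
  have hsub : {γ : HexDomainSAW D.carrier δ (a δ) (b δ) |
      ¬ ∃ (n m : ℕ) (p q : HexVertex) (n' m' : ℕ) (p' q' : HexVertex),
        IsFirstGoodGateN D.carrier δ ρ R S (a δ) γ.walk.support n m p q ∧
        IsFirstGoodGateN D.carrier δ ρ R T (b δ) γ.walk.support.reverse n' m' p' q' ∧
        WideLink D.carrier δ ρ (S n ∪ T n') q q'} ⊆
      {γ | ¬ GoodRenewalAtN D.carrier δ ρ R S (a δ) γ.walk.support} ∪
        {γ | ¬ GoodRenewalAtN D.carrier δ ρ R T (b δ) γ.walk.support.reverse} := by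
    intro γ hγ
    by_contra hcon
    simp only [Set.mem_union, Set.mem_setOf_eq, not_or, not_not] at hcon
    exact hγ (hlink γ.walk.support hcon.1 hcon.2)
  -- the `b`-end term by reversal symmetry
  have hrev : hexSAWLaw D.carrier δ (a δ) (b δ)
        {γ | ¬ GoodRenewalAtN D.carrier δ ρ R T (b δ) γ.walk.support.reverse} =
      hexSAWLaw D.carrier δ (b δ) (a δ) {γ | ¬ GoodRenewalAtN D.carrier δ ρ R T (b δ) γ.walk.support} :=
    stub_hexSAWLaw_reverse_apply D.carrier δ (a δ) (b δ)
      (fun l => ¬ GoodRenewalAtN D.carrier δ ρ R T (b δ) l)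
  refine (measure_mono hsub).trans ((measure_union_le _ _).trans ?_)
  calc hexSAWLaw D.carrier δ (a δ) (b δ) {γ | ¬ GoodRenewalAtN D.carrier δ ρ R S (a δ) γ.walk.support} +
        hexSAWLaw D.carrier δ (a δ) (b δ)
          {γ | ¬ GoodRenewalAtN D.carrier δ ρ R T (b δ) γ.walk.support.reverse}
      ≤ ENNReal.ofReal (ε / 2) + ENNReal.ofReal (ε / 2) :=
        add_le_add hPS (by rw [hrev]; exact hPT)
    _ = ENNReal.ofReal ε := by rw [← ENNReal.ofReal_add hε2.le hε2.le, add_halves]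

end Summit.CriticalPhenomena.SAWScalingLimit.Theorems.ObservableToSLE.TypeLadder

end
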